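import Mathlib
import Summits.ABC.ABC.Statement
import Summits.ABC.ABC.Theorems.SoloInformedRNShapeTwoSided

/-!
# The RN face at the ramified prime: the unit is a fourth root of unity, and the translation
# "restricted rational approximation along `qᵏ` ⟹ RN-shape"; uniform version ⟹ (RN-diag)
# (solo-ABC-informed, s16)

Companion to `SoloInformedRNDiag`. Four kernel facts behind the s16 correction.

1. `soloInformed_unit_pow_four_mod` (+ `_half`): if `u² − q v² = ±1` (resp. `±4`, `q` odd) then
   `u⁴ ≡ 1 (mod q)` (resp. `(u/2)⁴ ≡ 1`). In `ℚ(√q)` the fundamental unit `η = u + v√q` (or `(u + v√q)/2`)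
   is `≡ u` (resp. `u/2`) modulo the RAMIFIED prime `(√q)`, so `η⁴ ≡ 1 (mod (√q))`: in the Bugeaud–Laurent
   bound for two `q`-adic logarithms (M. A. Bennett, Y. Bugeaud, Acta Arith. 155 (2012), Theorem 2.1 p. 263:
   the residue parameter `g` = least positive integer with `ν_p(αᵢ^g − 1) > 0`, "g ≤ p^D − 1" in general)
   one has `g ≤ 4` independently of `q` — the residue-torsion factor that every other effective engine pays
   per prime is absent on this face; what remains of the bound is the regulator `R_q = log η` through the
   heights (ibid. p. 264: "An annoying feature of estimates for linear forms in p-adic logarithms is the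
   strong dependence of the bound on the prime number p, unless the algebraic numbers involved are
   p-adically close to 1").
2. `soloInformed_rn_of_restrictedApprox`, `soloInformed_rnShape_of_restrictedApprox`: the three-line
   translation used in the correction. A restricted approximation measure `c·q^{−(1−τ)k} < |x − qᵏ√q|`
   (Bennett–Bugeaud Theorem 1.2 p. 261 supplies it, with effective `c = c(ξ, b) > 0`, `τ = τ(ξ, P) > 0`,
   for every base `b ≥ 2` and real quadratic `ξ`; here `ξ = √q`, `b = q`) gives on `x² + D = q^{2k+1}`,
   `D > 0`: `c·q^{τk}·√q < D`, hence the RN-shape `q^{2k+1} < q·(D/c)^{2/τ}` — per base, for every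
   non-square base. (Even exponents are trivial: `soloInformed_sq_gap`.)
3. `soloInformed_rnDiag_of_uniformRestrictedApprox`: if `τ` could be taken UNIFORM over all non-square
   bases `q` along the diagonal `(ξ, b) = (√q, q)`, with a constant allowed to decay polynomially in the
   base, `c·q^{−A}·q^{−(1−τ)k} < |x − qᵏ√q|` — the diagonal form of Bennett–Bugeaud's open problem (ibid.
   p. 262: "Prove that for every quadratic number ξ there exists an effectively computable positive number
   τ(ξ) such that v_e^b(ξ) ≤ 1 − τ(ξ) for every b ≥ 2"); `abc` predicts it with `(τ, A) = (1/3, 4/3)` on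
   coprime solutions, from `qⁿ < K·D⁶·q⁶` (`soloInformed_rnShape_of_abc`) — then (RN-diag) follows:
   `x² + D = qⁿ`, `0 < D < q` ⟹ `n ≤ N₀` with one `N₀`. `SoloInformedRNDiag` derives (RN-diag) from
   `abc`; unconditionally only `n ≲ √q·polylog` is known. This types the door of the face: any "uniform
   restricted approximation" statement is tested here first. (Without the allowance `q^{−A}` the
   hypothesis would be void at `k = 0`, since `‖√(m² + 1)‖ → 0`.)
4. `soloInformed_uniformRestrictedApprox_of_abc`: conversely `abc` gives the uniform hypothesis with
   `τ = 1/3`, `A = 4/3` (from `qⁿ < K·|x² − qⁿ|⁶·q⁶`, `SoloInformedRNShapeTwoSided`), so on this face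
   abc ⟹ (URA 1/3, 4/3) ⟹ (RN-diag), all kernel-checked; the unconditional gap is exactly a uniform `τ`.
[cite: BennettBugeaud2012, Thm 1.2 p.261, Thm 2.1 p.263, open problem p.262, p.264]
[cite: BauerBennett2002, Cor 1.7 p.216]
-/

namespace Summit.ABC.ABC.Theorems

/-- ℤ-heart of "`g ≤ 4` at the ramified prime": `u² − q v² = ±1 ⟹ q ∣ u⁴ − 1`
(`η = u + v√q ≡ u (mod √q)`, so `η⁴ ≡ 1`). [folklore] -/
theorem soloInformed_unit_pow_four_mod (q : ℕ) (u v : ℤ)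
    (h : u ^ 2 - q * v ^ 2 = 1 ∨ u ^ 2 - q * v ^ 2 = -1) : (q : ℤ) ∣ u ^ 4 - 1 := by
  rcases h with h | h
  · exact ⟨v ^ 2 * (u ^ 2 + 1), by linear_combination (u ^ 2 + 1) * h⟩
  · exact ⟨v ^ 2 * (u ^ 2 - 1), by linear_combination (u ^ 2 - 1) * h⟩

/-- Half-integral units (`q ≡ 5 mod 8`, `η = (u + v√q)/2`, `u² − q v² = ±4`): for odd `q` there is
`w ≡ u/2 (mod q)` with `w⁴ ≡ 1 (mod q)` — again `η⁴ ≡ 1 (mod (√q))`, `g ≤ 4`. [folklore] -/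
theorem soloInformed_unit_pow_four_mod_half (q : ℕ) (hq : Odd q) (u v : ℤ)
    (h : u ^ 2 - q * v ^ 2 = 4 ∨ u ^ 2 - q * v ^ 2 = -4) :
    ∃ w : ℤ, (q : ℤ) ∣ 2 * w - u ∧ (q : ℤ) ∣ w ^ 4 - 1 := by
  obtain ⟨m, hm⟩ := hq
  have hq' : (q : ℤ) = 2 * m + 1 := by exact_mod_cast hm
  have h16 : (q : ℤ) ∣ u ^ 4 - 16 := by
    rcases h with h | h
    · exact ⟨v ^ 2 * (u ^ 2 + 4), by linear_combination (u ^ 2 + 4) * h⟩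
    · exact ⟨v ^ 2 * (u ^ 2 - 4), by linear_combination (u ^ 2 - 4) * h⟩
  obtain ⟨r, hr⟩ := h16
  refine ⟨((m : ℤ) + 1) * u, ⟨u, by linear_combination (-u) * hq'⟩,
    ⟨((m : ℤ) + 1) ^ 4 * r + (2 * m + 3) * (4 * ((m : ℤ) + 1) ^ 2 + 1), ?_⟩⟩
  linear_combination ((m : ℤ) + 1) ^ 4 * hr - ((2 * (m : ℤ) + 3) * (4 * ((m : ℤ) + 1) ^ 2 + 1)) * hq'

/-- Squares versus squares: `x² + D = a²` with `D > 0` forces `a ≤ D` (indeed `D = (a − x)(a + x) ≥ a + x`).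
This is why even exponents are trivial on the RN face (`y^{2j} − x² ≥ y^j`). [folklore] -/
theorem soloInformed_sq_gap (a x D : ℕ) (hD : 0 < D) (h : x ^ 2 + D = a ^ 2) : a ≤ D := by
  have hax : x < a := by
    by_contra hle
    have hle' : a ≤ x := not_lt.mp hle
    have : a ^ 2 ≤ x ^ 2 := Nat.pow_le_pow_left hle' 2
    omega
  have h' : ((x : ℤ)) ^ 2 + D = (a : ℤ) ^ 2 := by exact_mod_cast h
  have hax' : (x : ℤ) + 1 ≤ a := by exact_mod_cast hax
  have : (a : ℤ) ≤ D := by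
    nlinarith [mul_nonneg (show (0 : ℤ) ≤ a - x - 1 by linarith) (show (0 : ℤ) ≤ a + x by positivity)]
  exact_mod_cast this

/-- **Translation lemma.** A restricted rational approximation measure for `√q` at the fraction `x/qᵏ`,
`c·q^{−(1−τ)k} < |x − qᵏ√q|`, gives on the solution `x² + D = q^{2k+1}`, `D > 0`, the inequality
`c·q^{τk}·√q < D` (since `|x − qᵏ√q| = D/(x + qᵏ√q) ≤ D/(qᵏ√q)`).
Bennett–Bugeaud 2012, Theorem 1.2 (p. 261) supplies the hypothesis for each non-square `q` with effective
`c, τ > 0` depending on `q`. [cite: BennettBugeaud2012, Thm 1.2 p.261] -/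
theorem soloInformed_rn_of_restrictedApprox (q : ℕ) (hq : 0 < q) (c τ : ℝ) (x D k : ℕ)
    (hRA : c * (q : ℝ) ^ (-(1 - τ) * (k : ℝ)) < |(x : ℝ) - (q : ℝ) ^ k * Real.sqrt q|)
    (hD : 0 < D) (h : x ^ 2 + D = q ^ (2 * k + 1)) :
    c * (q : ℝ) ^ (τ * (k : ℝ)) * Real.sqrt q < D := by
  have hq0 : (0 : ℝ) < q := by exact_mod_cast hq
  have hsq : Real.sqrt (q : ℝ) ^ 2 = q := Real.sq_sqrt hq0.le
  have hsqpos : 0 < Real.sqrt (q : ℝ) := Real.sqrt_pos.mpr hq0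
  obtain ⟨s, hs⟩ : ∃ s : ℝ, s = (q : ℝ) ^ k * Real.sqrt q := ⟨_, rfl⟩
  have hcast : ((x : ℝ)) ^ 2 + D = (q : ℝ) ^ (2 * k + 1) := by exact_mod_cast h
  have hs2 : s ^ 2 = (x : ℝ) ^ 2 + D := by
    rw [hcast, hs, mul_pow, hsq]; ring
  have hspos : 0 < s := by rw [hs]; positivity
  have hx0 : (0 : ℝ) ≤ x := by positivity
  have hD0 : (0 : ℝ) < D := by exact_mod_cast hD
  have hxs : (x : ℝ) < s := by nlinarith [hs2, hD0, hspos]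
  have habs : |(x : ℝ) - s| = s - x := by
    rw [abs_sub_comm]; exact abs_of_pos (by linarith)
  have hprod : (s - x) * (s + x) = D := by nlinarith [hs2]
  have hsx : (s - x) * s ≤ D := by nlinarith [hprod, hx0, hxs]
  have key := hRA
  rw [← hs, habs] at key
  have hlt : c * (q : ℝ) ^ (-(1 - τ) * (k : ℝ)) * s < D :=
    lt_of_lt_of_le (mul_lt_mul_of_pos_right key hspos) hsx
  have hrew : (q : ℝ) ^ (-(1 - τ) * (k : ℝ)) * ((q : ℝ) ^ k * Real.sqrt q)
      = (q : ℝ) ^ (τ * (k : ℝ)) * Real.sqrt q := by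
    rw [← mul_assoc, ← Real.rpow_natCast (q : ℝ) k, ← Real.rpow_add hq0,
      show -(1 - τ) * (k : ℝ) + ((k : ℕ) : ℝ) = τ * (k : ℝ) by ring]
  calc c * (q : ℝ) ^ (τ * (k : ℝ)) * Real.sqrt q
      = c * ((q : ℝ) ^ (-(1 - τ) * (k : ℝ)) * ((q : ℝ) ^ k * Real.sqrt q)) := by rw [hrew]; ring
    _ = c * (q : ℝ) ^ (-(1 - τ) * (k : ℝ)) * s := by rw [hs]; ring
    _ < D := hlt

/-- **RN-shape per base from a restricted approximation measure**: with `c, τ > 0` as in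
`soloInformed_rn_of_restrictedApprox`, every solution of `x² + D = q^{2k+1}`, `D > 0`, has
`q^{2k+1} < q·(D/c)^{2/τ}` — i.e. `qⁿ ≤ K_q·D^{M_q}` with `M_q = 2/τ`. This is the statement s15 wrongly
called open at `q = 5`: it holds for every non-square base by Bennett–Bugeaud 2012, Thm 1.2, and with
`M = 3.125` at `q = 5` by Bauer–Bennett 2002, Cor. 1.7. [cite: BennettBugeaud2012, Thm 1.2 p.261] -/
theorem soloInformed_rnShape_of_restrictedApprox (q : ℕ) (hq : 0 < q) (c τ : ℝ) (hc : 0 < c)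
    (hτ : 0 < τ) (x D k : ℕ)
    (hRA : c * (q : ℝ) ^ (-(1 - τ) * (k : ℝ)) < |(x : ℝ) - (q : ℝ) ^ k * Real.sqrt q|)
    (hD : 0 < D) (h : x ^ 2 + D = q ^ (2 * k + 1)) :
    (q : ℝ) ^ (2 * k + 1) < q * ((D : ℝ) / c) ^ (2 / τ) := by
  have hq0 : (0 : ℝ) < q := by exact_mod_cast hq
  have h1 := soloInformed_rn_of_restrictedApprox q hq c τ x D k hRA hD h
  have hq1 : (1 : ℝ) ≤ Real.sqrt q := by
    have h1q : (1 : ℝ) ≤ q := by exact_mod_cast hq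
    have := Real.sqrt_le_sqrt h1q
    simpa using this
  have hpow : 0 < (q : ℝ) ^ (τ * (k : ℝ)) := Real.rpow_pos_of_pos hq0 _
  have h2 : c * (q : ℝ) ^ (τ * (k : ℝ)) < D := by
    have : c * (q : ℝ) ^ (τ * (k : ℝ)) * 1 ≤ c * (q : ℝ) ^ (τ * (k : ℝ)) * Real.sqrt q :=
      mul_le_mul_of_nonneg_left hq1 (by positivity)
    linarith
  have h3 : (q : ℝ) ^ (τ * (k : ℝ)) < (D : ℝ) / c := by
    rw [lt_div_iff₀ hc]; linarith
  have hDc : (0 : ℝ) < (D : ℝ) / c := by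
    have hD0 : (0 : ℝ) < D := by exact_mod_cast hD
    positivity
  have h4 : (q : ℝ) ^ (k : ℝ) < ((D : ℝ) / c) ^ (1 / τ) := by
    have := Real.rpow_lt_rpow hpow.le h3 (by positivity : (0 : ℝ) < 1 / τ)
    rwa [← Real.rpow_mul hq0.le, show τ * (k : ℝ) * (1 / τ) = (k : ℝ) by field_simp] at this
  have hB : 0 < ((D : ℝ) / c) ^ (1 / τ) := Real.rpow_pos_of_pos hDc _
  have hA : 0 ≤ (q : ℝ) ^ (k : ℝ) := (Real.rpow_pos_of_pos hq0 _).le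
  have h6 : ((q : ℝ) ^ (k : ℝ)) ^ 2 < (((D : ℝ) / c) ^ (1 / τ)) ^ 2 :=
    sq_lt_sq' (by linarith) h4
  have h5 : (q : ℝ) ^ (2 * k + 1) = q * ((q : ℝ) ^ (k : ℝ)) ^ 2 := by
    rw [Real.rpow_natCast]; ring
  have h7 : (((D : ℝ) / c) ^ (1 / τ)) ^ 2 = ((D : ℝ) / c) ^ (2 / τ) := by
    rw [← Real.rpow_natCast (((D : ℝ) / c) ^ (1 / τ)) 2, ← Real.rpow_mul hDc.le]
    congr 1
    push_cast; ring
  rw [h5, ← h7]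
  exact mul_lt_mul_of_pos_left h6 hq0

/-- **(RN-diag) from UNIFORM restricted approximation on the diagonal** — the typed door of the face.
If one triple `c, τ > 0`, `A` served for EVERY non-square base `q` (`c·q^{−A}·q^{−(1−τ)k} < |x − qᵏ√q|`
for all `k` and all `x` prime to `q`, i.e. at fractions `x/qᵏ` in lowest terms: one `τ` for all bases, the constant allowed to decay like a fixed power of the base — the
diagonal `(ξ, b) = (√q, q)` form of Bennett–Bugeaud's open problem, Acta Arith. 155 p. 262; `abc` predicts
`τ = 1/3`, `A = 4/3`), then `x² + D = qⁿ` with `0 < D < q` would force `n ≤ N₀` with a single `N₀`. From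
`abc` this conclusion is `soloInformed_rnDiag_of_abc`, and `abc` gives the hypothesis itself
(`soloInformed_uniformRestrictedApprox_of_abc`); unconditionally every effective route loses `≳ √q`
(class number of `ℚ(√−D)`, regulator of `ℚ(√q)`, or a Frey level). Squares and even exponents are handled by
`soloInformed_sq_gap`. [cite: BennettBugeaud2012, open problem p.262] -/
theorem soloInformed_rnDiag_of_uniformRestrictedApprox
    (hU : ∃ c τ A : ℝ, 0 < c ∧ 0 < τ ∧ ∀ q : ℕ, ¬ IsSquare q →
      ∀ k x : ℕ, Nat.Coprime x q → c * (q : ℝ) ^ (-A) * (q : ℝ) ^ (-(1 - τ) * (k : ℝ))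
        < |(x : ℝ) - (q : ℝ) ^ k * Real.sqrt q|) :
    ∃ N₀ : ℕ, ∀ q x D n : ℕ, 0 < D → Nat.Coprime D x → x ^ 2 + D = q ^ n → D < q → n ≤ N₀ := by
  obtain ⟨c, τ, A, hc, hτ, hU⟩ := hU
  -- the uniform bound on `k` for odd exponents `n = 2k + 1`
  obtain ⟨M, hM⟩ := exists_nat_gt (max ((A + 1 / 2) / τ) ((Real.logb 2 (1 / c) + 1 / 2 + A) / τ))
  refine ⟨2 * M + 2, fun q x D n hD hcop h hDq => ?_⟩
  have hq2 : 2 ≤ q := by omega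
  -- even exponents and square bases: `n ≤ 1`
  have heven : ∀ r j : ℕ, 2 ≤ r → x ^ 2 + D = (r ^ j) ^ 2 → D < r ^ 2 → j ≤ 1 := by
    intro r j hr hj hDr
    have hle := soloInformed_sq_gap (r ^ j) x D hD hj
    by_contra hj1
    have hj2 : 2 ≤ j := by omega
    have : r ^ 2 ≤ r ^ j := Nat.pow_le_pow_right (by omega) hj2
    omega
  by_cases hsqr : IsSquare q
  · obtain ⟨r, hr⟩ := hsqr
    have hr2 : 2 ≤ r := by
      rcases Nat.lt_or_ge r 2 with hr1 | hr1
      · interval_cases r <;> omega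
      · exact hr1
    have hj : x ^ 2 + D = (r ^ n) ^ 2 := by rw [h, hr]; ring
    have := heven r n hr2 hj (by nlinarith [hDq, hr])
    omega
  rcases Nat.even_or_odd n with ⟨j, hj⟩ | ⟨k, hk⟩
  · -- n = j + j
    have hj' : x ^ 2 + D = (q ^ j) ^ 2 := by rw [h, hj]; ring
    have := heven q j hq2 hj' (by nlinarith [hDq])
    omega
  · -- n = 2k + 1: the restricted approximation measure bounds k uniformly
    have hq0 : (0 : ℝ) < q := by exact_mod_cast (show 0 < q by omega)
    have hq2r : (2 : ℝ) ≤ q := by exact_mod_cast hq2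
    have hxq : Nat.Coprime x q := by
      have h1 : Nat.Coprime (D + x * x) x := (Nat.coprime_add_mul_left_left D x x).mpr hcop
      rw [show D + x * x = q ^ (2 * k + 1) by rw [← hk]; nlinarith [h]] at h1
      exact ((Nat.coprime_pow_left_iff (by omega) q x).mp h1).symm
    have h1 := soloInformed_rn_of_restrictedApprox q (by omega) (c * (q : ℝ) ^ (-A)) τ x D k
      (hU q hsqr k x hxq) hD (by rw [h, hk])
    have hDq' : (D : ℝ) < q := by exact_mod_cast hDq
    have hsq : Real.sqrt (q : ℝ) = (q : ℝ) ^ ((1 : ℝ) / 2) := Real.sqrt_eq_rpow (q : ℝ)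
    have hsqpos : 0 < Real.sqrt (q : ℝ) := Real.sqrt_pos.mpr hq0
    have hqA : 0 < (q : ℝ) ^ (-A) := Real.rpow_pos_of_pos hq0 _
    -- c q^(-A) q^(τk) √q < q = √q √q  ⟹  c q^(-A) q^(τk) < √q  ⟹  q^(τk - 1/2 - A) < 1/c
    have hqq : (q : ℝ) = Real.sqrt q * Real.sqrt q := (Real.mul_self_sqrt hq0.le).symm
    have h2 : c * (q : ℝ) ^ (-A) * (q : ℝ) ^ (τ * (k : ℝ)) < Real.sqrt q := by
      have : c * (q : ℝ) ^ (-A) * (q : ℝ) ^ (τ * (k : ℝ)) * Real.sqrt q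
          < Real.sqrt q * Real.sqrt q := by
        linarith [h1, hDq']
      exact lt_of_mul_lt_mul_right this hsqpos.le
    have h3 : (q : ℝ) ^ (τ * (k : ℝ) - 1 / 2 - A) < 1 / c := by
      rw [show τ * (k : ℝ) - 1 / 2 - A = (-A + τ * (k : ℝ)) - 1 / 2 by ring,
        Real.rpow_sub hq0, Real.rpow_add hq0, ← hsq, div_lt_iff₀ hsqpos]
      calc (q : ℝ) ^ (-A) * (q : ℝ) ^ (τ * (k : ℝ))
          = (c * (q : ℝ) ^ (-A) * (q : ℝ) ^ (τ * (k : ℝ))) / c := by field_simp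
        _ < Real.sqrt q / c := div_lt_div_of_pos_right h2 hc
        _ = 1 / c * Real.sqrt q := by ring
    suffices hkM : (k : ℝ) < max ((A + 1 / 2) / τ) ((Real.logb 2 (1 / c) + 1 / 2 + A) / τ) by
      have : (k : ℝ) < M := lt_trans hkM hM
      have : k < M := by exact_mod_cast this
      omega
    by_cases hsmall : τ * (k : ℝ) - 1 / 2 - A < 0
    · apply lt_max_of_lt_left
      rw [lt_div_iff₀ hτ]
      linarith
    · have hexp : 0 ≤ τ * (k : ℝ) - 1 / 2 - A := not_lt.mp hsmall
      apply lt_max_of_lt_right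
      have h4 : (2 : ℝ) ^ (τ * (k : ℝ) - 1 / 2 - A) ≤ (q : ℝ) ^ (τ * (k : ℝ) - 1 / 2 - A) :=
        Real.rpow_le_rpow (by norm_num) hq2r hexp
      have h5 : (2 : ℝ) ^ (τ * (k : ℝ) - 1 / 2 - A) < (2 : ℝ) ^ (Real.logb 2 (1 / c)) := by
        rw [Real.rpow_logb (by norm_num) (by norm_num) (by positivity)]
        exact lt_of_le_of_lt h4 h3
      have h6 : τ * (k : ℝ) - 1 / 2 - A < Real.logb 2 (1 / c) :=
        (Real.rpow_lt_rpow_left_iff (by norm_num : (1 : ℝ) < 2)).mp h5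
      rw [lt_div_iff₀ hτ]
      linarith

/-- **abc ⟹ uniform restricted approximation on the diagonal, in lowest terms** (`τ = 1/3`, `A = 4/3`):
from `qⁿ < K·|x² − qⁿ|⁶·q⁶` (`soloInformed_squares_vs_powers_of_abc`), for every base `q ≥ 2`, every `k`
and every `x` prime to `q`: `c·q^{−4/3}·q^{−(2/3)k} < |x − qᵏ√q|` with ONE `c > 0`. With
`soloInformed_rnDiag_of_uniformRestrictedApprox` this sandwiches the uniform restricted-approximation
statement on this face: abc ⟹ (URA: τ = 1/3, A = 4/3) ⟹ (RN-diag). Unconditionally (URA) is known for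
no `τ > 0` with any `A` (Bennett–Bugeaud's `τ(√q, {q})` is not bounded below in print). [folklore] -/
theorem soloInformed_uniformRestrictedApprox_of_abc (habc : _root_.ABC) :
    ∃ c : ℝ, 0 < c ∧ ∀ q k x : ℕ, 2 ≤ q → Nat.Coprime x q →
      c * (q : ℝ) ^ (-(4 / 3 : ℝ)) * (q : ℝ) ^ (-(1 - 1 / 3) * (k : ℝ))
        < |(x : ℝ) - (q : ℝ) ^ k * Real.sqrt q| := by
  obtain ⟨K, hK, hK'⟩ := soloInformed_squares_vs_powers_of_abc habc
  obtain ⟨c₀, hc₀⟩ : ∃ c₀ : ℝ, c₀ = (1 / K) ^ ((1 : ℝ) / 6) / 3 := ⟨_, rfl⟩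
  have hc₀pos : 0 < c₀ := by rw [hc₀]; positivity
  refine ⟨min (1 / 2) c₀, lt_min (by norm_num) hc₀pos, fun q k x hq hcop => ?_⟩
  have hq0 : (0 : ℝ) < q := by exact_mod_cast (show 0 < q by omega)
  have hq1 : (1 : ℝ) ≤ q := by exact_mod_cast (show 1 ≤ q by omega)
  obtain ⟨s, hs⟩ : ∃ s : ℝ, s = (q : ℝ) ^ k * Real.sqrt q := ⟨_, rfl⟩
  have hsq : Real.sqrt (q : ℝ) ^ 2 = q := Real.sq_sqrt hq0.le
  have hs2 : s ^ 2 = (q : ℝ) ^ (2 * k + 1) := by rw [hs, mul_pow, hsq]; ring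
  have hs1 : 1 ≤ s := by
    have h1 : (1 : ℝ) ≤ (q : ℝ) ^ k := by exact_mod_cast Nat.one_le_pow k q (by omega)
    have h2 : (1 : ℝ) ≤ Real.sqrt q := by simpa using Real.sqrt_le_sqrt hq1
    rw [hs]; nlinarith
  -- abbreviation for the small factor
  obtain ⟨P, hP⟩ : ∃ P : ℝ, P = (q : ℝ) ^ (-(4 / 3 : ℝ)) * (q : ℝ) ^ (-(1 - 1 / 3) * (k : ℝ)) :=
    ⟨_, rfl⟩
  have hPpos : 0 < P := by rw [hP]; positivity
  have hPle : P ≤ 1 := by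
    have a1 : (q : ℝ) ^ (-(4 / 3 : ℝ)) ≤ 1 := Real.rpow_le_one_of_one_le_of_nonpos hq1 (by norm_num)
    have hk0 : (0 : ℝ) ≤ k := by positivity
    have a2 : (q : ℝ) ^ (-(1 - 1 / 3) * (k : ℝ)) ≤ 1 :=
      Real.rpow_le_one_of_one_le_of_nonpos hq1 (by nlinarith)
    rw [hP]
    calc (q : ℝ) ^ (-(4 / 3 : ℝ)) * (q : ℝ) ^ (-(1 - 1 / 3) * (k : ℝ)) ≤ 1 * 1 :=
          mul_le_mul a1 a2 (Real.rpow_pos_of_pos hq0 _).le (by norm_num)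
      _ = 1 := by ring
  rw [← hs, show min (1 / 2) c₀ * (q : ℝ) ^ (-(4 / 3 : ℝ)) * (q : ℝ) ^ (-(1 - 1 / 3) * (k : ℝ))
      = min (1 / 2) c₀ * P by rw [hP]; ring]
  have hmin1 : min (1 / 2) c₀ * P ≤ 1 / 2 := by
    have hm : min (1 / 2) c₀ ≤ 1 / 2 := min_le_left _ _
    nlinarith
  have hmin2 : min (1 / 2) c₀ * P ≤ c₀ * P := by
    have hm : min (1 / 2) c₀ ≤ c₀ := min_le_right _ _
    nlinarith
  by_cases hfar : 2 * s < x
  · -- far side: |x - s| = x - s > s ≥ 1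
    have : (1 : ℝ) < |(x : ℝ) - s| := by
      rw [abs_of_pos (by linarith)]; linarith
    linarith
  · have hxle : (x : ℝ) ≤ 2 * s := not_lt.mp hfar
    have hx0 : (0 : ℝ) ≤ x := by positivity
    -- `x² ≠ q^(2k+1)` because `x` is prime to `q ≥ 2`
    have hne : x ^ 2 ≠ q ^ (2 * k + 1) := by
      intro hx
      have h1 : Nat.Coprime (x ^ 2) (q ^ (2 * k + 1)) := Nat.Coprime.pow 2 (2 * k + 1) hcop
      rw [hx] at h1
      have h2 : q ^ (2 * k + 1) = 1 := (Nat.coprime_self _).mp h1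
      have h3 : q ≤ q ^ (2 * k + 1) := Nat.le_self_pow (by omega) q
      omega
    have hC := hK' q (2 * k + 1) x (by omega) hcop.symm hne
    -- the integer `D' = |x² − q^(2k+1)|` as a real number
    have hD' : ((((x : ℤ) ^ 2 - (q : ℤ) ^ (2 * k + 1)).natAbs : ℕ) : ℝ) = |(x : ℝ) ^ 2 - s ^ 2| := by
      rw [hs2, Nat.cast_natAbs]; push_cast; rfl
    rw [hD'] at hC
    -- |x - s| (x + s) = |x² - s²| and x + s ≤ 3 s
    have hfac : |(x : ℝ) - s| * ((x : ℝ) + s) = |(x : ℝ) ^ 2 - s ^ 2| := by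
      rw [show (x : ℝ) ^ 2 - s ^ 2 = ((x : ℝ) - s) * ((x : ℝ) + s) by ring, abs_mul,
        abs_of_pos (by linarith : (0 : ℝ) < x + s)]
    have hxs3 : (x : ℝ) + s ≤ 3 * s := by linarith
    -- t := (1/K)^{1/6} q^{(2k-5)/6};  t⁶ = q^(2k+1)/(K q⁶) < |x² - s²|⁶
    obtain ⟨t, ht⟩ : ∃ t : ℝ, t = (1 / K) ^ ((1 : ℝ) / 6) * (q : ℝ) ^ ((2 * (k : ℝ) - 5) / 6) :=
      ⟨_, rfl⟩
    have htpos : 0 < t := by rw [ht]; positivity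
    have e1 : ((1 / K) ^ ((1 : ℝ) / 6)) ^ (6 : ℕ) = 1 / K := by
      rw [← Real.rpow_natCast, ← Real.rpow_mul (by positivity)]; norm_num
    have e2 : ((q : ℝ) ^ ((2 * (k : ℝ) - 5) / 6)) ^ (6 : ℕ) = (q : ℝ) ^ (2 * k + 1) / (q : ℝ) ^ 6 := by
      rw [← Real.rpow_natCast ((q : ℝ) ^ ((2 * (k : ℝ) - 5) / 6)) 6, ← Real.rpow_mul hq0.le,
        show (2 * (k : ℝ) - 5) / 6 * ((6 : ℕ) : ℝ) = ((2 * k + 1 : ℕ) : ℝ) - ((6 : ℕ) : ℝ) by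
          push_cast; ring,
        Real.rpow_sub hq0, Real.rpow_natCast, Real.rpow_natCast]
    have ht6 : t ^ 6 = 1 / K * ((q : ℝ) ^ (2 * k + 1) / (q : ℝ) ^ 6) := by
      rw [ht, mul_pow, e1, e2]
    have htD : t < |(x : ℝ) ^ 2 - s ^ 2| := by
      have h6 : t ^ 6 < |(x : ℝ) ^ 2 - s ^ 2| ^ 6 := by
        rw [ht6, show 1 / K * ((q : ℝ) ^ (2 * k + 1) / (q : ℝ) ^ 6)
            = (q : ℝ) ^ (2 * k + 1) / (K * (q : ℝ) ^ 6) by field_simp, div_lt_iff₀ (by positivity)]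
        linarith [hC]
      by_contra hle
      have hle' : |(x : ℝ) ^ 2 - s ^ 2| ≤ t := not_lt.mp hle
      have : |(x : ℝ) ^ 2 - s ^ 2| ^ 6 ≤ t ^ 6 := by gcongr
      linarith
    -- c₀ P (3 s) = t
    have hkey : c₀ * P * (3 * s) = t := by
      have hexp : (q : ℝ) ^ (-(4 / 3 : ℝ)) * (q : ℝ) ^ (-(1 - 1 / 3) * (k : ℝ))
          * ((q : ℝ) ^ ((k : ℕ) : ℝ) * (q : ℝ) ^ ((1 : ℝ) / 2)) = (q : ℝ) ^ ((2 * (k : ℝ) - 5) / 6) := by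
        rw [← Real.rpow_add hq0, ← Real.rpow_add hq0, ← Real.rpow_add hq0]
        congr 1
        ring
      rw [hc₀, hP, ht, hs, ← Real.rpow_natCast (q : ℝ) k, Real.sqrt_eq_rpow, ← hexp]
      ring
    have hxs_pos : (0 : ℝ) < x + s := by linarith
    have hcP : 0 ≤ c₀ * P := by positivity
    have hlt : c₀ * P * ((x : ℝ) + s) < |(x : ℝ) - s| * ((x : ℝ) + s) := by
      calc c₀ * P * ((x : ℝ) + s) ≤ c₀ * P * (3 * s) := mul_le_mul_of_nonneg_left hxs3 hcP
        _ = t := hkey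
        _ < |(x : ℝ) ^ 2 - s ^ 2| := htD
        _ = |(x : ℝ) - s| * ((x : ℝ) + s) := hfac.symm
    have := lt_of_mul_lt_mul_right hlt hxs_pos.le
    linarith

end Summit.ABC.ABC.Theorems
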